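import Mathlib
import HarnessLib
import Literature.Analysis.FunctionSpaces.BesselIDerivative
import Summits.Ventures.LatticeQCDFlow.Scoring.BesselIRatioWeakCoupling
import Summits.Ventures.LatticeQCDFlow.Scaling.U1IdentityFlowVolumeLaw

/-!
# LatticeQCDFlow / Scaling — the WEAK-COUPLING EXPONENT of the untrained U(1) sampler:
# `log(I₀(β/2)²/I₀(β))/log β → −1/2`, `log(I₀(β)²/I₀(2β))/log β → −1/2`, hence
# `log ESS_V(β)/log β → −V/2` and `log acc_V(β)/log β → −V/2` for `V` plaquettes

HONEST FRAMING: exact (Metropolis-corrected) sampling algorithms for lattice gauge theory;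
figures of merit are autocorrelation/cost numbers at stated couplings and volumes; no
continuum-physics claim.

Venture `LatticeQCDFlow` (cell pub-lqcd), topic `Scaling`; FANOUT row 3 (`s0-u1-a`, S0-B
implementation A, GEN-16).  NEW WORK of the cell (elementary real analysis), not a published result;
NO definition is introduced.  Row 3's `Scaling/U1IdentityFlowVolumeLaw` (GEN-12, imported) pins the
untrained exact sampler of `V` independent U(1) plaquettes: `ESS_V = (I₀(β)²/I₀(2β))^V` exactly and
`(8/9)·ESS_V ≤ acc_V ≤ (I₀(β/2)²/I₀(β))^V`.  Row 5's weak-coupling law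
`β(1 − I₁(β)/I₀(β)) → ½` (`Scoring/BesselIRatioWeakCoupling`, imported) and `I₀' = I₁`
(`Literature…BesselIDerivative`, imported) give the logarithmic derivatives of both per-plaquette
constants the asymptotics `−1/(2β)`, whence the POWER-LAW EXPONENT `−1/2` per plaquette:

* §1 **`tendsto_div_log_of_tendsto_mul_hasDerivAt`** — a real-variable lemma: if `f` is
  differentiable on a half-line and `β·f'(β) → c`, then `f(β)/log β → c` (comparison with
  `(c ± ε)·log β` by the sign of the derivative; no l'Hôpital rule is used);
* §2 `hasDerivAt_log_besselI_zero` (`(log I₀)' = I₁/I₀`), `hasDerivAt_log_bhattSq`,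
  `hasDerivAt_log_essOne`; **`tendsto_mul_deriv_log_bhattSq`** `β·(log(I₀(β/2)²/I₀(β)))' → −½`,
  **`tendsto_mul_deriv_log_essOne`** `β·(log(I₀(β)²/I₀(2β)))' → −½`;
* §3 **`tendsto_log_bhattSq_div_log`** `log(I₀(β/2)²/I₀(β))/log β → −½` and
  **`tendsto_log_essOne_div_log`** `log(I₀(β)²/I₀(2β))/log β → −½`;
* §4 `V` plaquettes: **`u1IdentityFlow_log_essFrac_div_log_tendsto`** `log ESS_V/log β → −V/2` and
  **`u1IdentityFlow_log_meanAccept_div_log_tendsto`** `log acc_V/log β → −V/2` (the acceptance is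
  squeezed between `(8/9)·ESS_V` and the ceiling, whose exponents coincide).

Reading (value-free; no number of ours is computed or implied): at weak coupling the untrained
U(1) sampler's ESS, acceptance ceiling AND acceptance all decay as the power `β^{−V/2}` of the
coupling — exponent exactly `V/2`, polynomial per plaquette, so the exponential-in-volume law has
a rate growing like `(V/2)·log β`.  NOT CLAIMED: the constants (`√(2/(πβ))`, `1/√(πβ)` are classical
asymptotics, not typed); anything for trained flows; any value at the cell's `(β, L)`; nothing
re-scored, SEALED.md untouched.
-/

noncomputable section

namespace Summit.Ventures.LatticeQCDFlow.Theory2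

open MeasureTheory Real Set Filter Topology
open Literature.Analysis.FunctionSpaces (besselI besselI_zero_pos hasDerivAt_besselI_zero)
open Summit.Ventures.LatticeQCDFlow.Scoring (onePlaquetteZ tendsto_beta_mul_one_sub_besselRatio)

/-! ## §1 `β f'(β) → c` implies `f(β)/log β → c` -/

section RealVariable

/-- **If `f` is differentiable on `[a, ∞)` and `β·f'(β) → c` then `f(β)/log β → c`.** [folklore] -/
theorem tendsto_div_log_of_tendsto_mul_hasDerivAt {f f' : ℝ → ℝ} {c a : ℝ}
    (hf : ∀ x, a ≤ x → HasDerivAt f (f' x) x)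
    (hlim : Tendsto (fun x => x * f' x) atTop (𝓝 c)) :
    Tendsto (fun x => f x / Real.log x) atTop (𝓝 c) := by
  refine Metric.tendsto_atTop.2 fun ε hε => ?_
  obtain ⟨b, hb⟩ := Metric.tendsto_atTop.1 hlim (ε / 2) (half_pos hε)
  set β₀ : ℝ := max (max a 2) b with hβ₀
  have hβ₀a : a ≤ β₀ := le_trans (le_max_left a 2) (le_max_left _ _)
  have hβ₀2 : (2 : ℝ) ≤ β₀ := le_trans (le_max_right a 2) (le_max_left _ _)
  have hβ₀b : b ≤ β₀ := le_max_right _ _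
  -- derivative bounds on `[β₀, ∞)`
  have hbd : ∀ x, β₀ ≤ x → f' x ≤ (c + ε / 2) * x⁻¹ ∧ (c - ε / 2) * x⁻¹ ≤ f' x := by
    intro x hx
    have hx0 : 0 < x := by linarith
    have h := hb x (le_trans hβ₀b hx)
    rw [Real.dist_eq, abs_lt] at h
    constructor
    · rw [← div_eq_mul_inv, le_div_iff₀ hx0]; linarith [mul_comm x (f' x)]
    · rw [← div_eq_mul_inv, div_le_iff₀ hx0]; linarith [mul_comm x (f' x)]
  have hcont : ∀ k : ℝ, ContinuousOn (fun x => f x - k * Real.log x) (Ici β₀) := fun k x hx =>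
    ((hf x (le_trans hβ₀a hx)).continuousAt.sub
      ((Real.continuousAt_log (by linarith [mem_Ici.1 hx] : x ≠ 0)).const_smul k |>.congr
        (Eventually.of_forall fun y => by simp [smul_eq_mul]))).continuousWithinAt
  have hder : ∀ k : ℝ, ∀ x ∈ interior (Ici β₀),
      HasDerivWithinAt (fun x => f x - k * Real.log x) (f' x - k * x⁻¹) (interior (Ici β₀)) x := by
    intro k x hx
    rw [interior_Ici] at hx
    have hx' : β₀ < x := hx
    exact ((hf x (by linarith)).sub ((Real.hasDerivAt_log (by linarith)).const_mul k)).hasDerivWithinAt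
  -- `f − (c + ε/2) log` is non-increasing, `f − (c − ε/2) log` non-decreasing on `[β₀, ∞)`
  have hanti : AntitoneOn (fun x => f x - (c + ε / 2) * Real.log x) (Ici β₀) :=
    antitoneOn_of_hasDerivWithinAt_nonpos (convex_Ici β₀) (hcont _) (hder _) fun x hx => by
      rw [interior_Ici] at hx
      linarith [(hbd x (le_of_lt hx)).1]
  have hmono : MonotoneOn (fun x => f x - (c - ε / 2) * Real.log x) (Ici β₀) :=
    monotoneOn_of_hasDerivWithinAt_nonneg (convex_Ici β₀) (hcont _) (hder _) fun x hx => by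
      rw [interior_Ici] at hx
      linarith [(hbd x (le_of_lt hx)).2]
  set C₁ : ℝ := f β₀ - (c + ε / 2) * Real.log β₀ with hC₁
  set C₂ : ℝ := f β₀ - (c - ε / 2) * Real.log β₀ with hC₂
  -- the constants are negligible against `log x`
  have hC : Tendsto (fun x => (|C₁| + |C₂|) / Real.log x) atTop (𝓝 0) :=
    tendsto_const_nhds.div_atTop Real.tendsto_log_atTop
  obtain ⟨N, hN⟩ := Metric.tendsto_atTop.1 hC (ε / 2) (half_pos hε)
  refine ⟨max β₀ N, fun x hx => ?_⟩
  have hxβ : β₀ ≤ x := le_trans (le_max_left _ _) hx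
  have hxN : N ≤ x := le_trans (le_max_right _ _) hx
  have hlog : 0 < Real.log x := Real.log_pos (by linarith)
  have hup : f x ≤ C₁ + (c + ε / 2) * Real.log x := by
    have := hanti (mem_Ici.2 le_rfl) (mem_Ici.2 hxβ) hxβ
    simp only at this; linarith
  have hlo : C₂ + (c - ε / 2) * Real.log x ≤ f x := by
    have := hmono (mem_Ici.2 le_rfl) (mem_Ici.2 hxβ) hxβ
    simp only at this; linarith
  have hsmall := hN x hxN
  rw [Real.dist_eq, sub_zero, abs_of_nonneg (div_nonneg (by positivity) hlog.le)] at hsmall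
  have h1 : f x / Real.log x ≤ (|C₁| + |C₂|) / Real.log x + (c + ε / 2) := by
    rw [div_add' _ _ _ hlog.ne', div_le_div_iff_of_pos_right hlog]
    linarith [le_abs_self C₁, abs_nonneg C₂]
  have h2 : (c - ε / 2) - (|C₁| + |C₂|) / Real.log x ≤ f x / Real.log x := by
    rw [sub_div' hlog.ne', div_le_div_iff_of_pos_right hlog]
    linarith [neg_abs_le C₂, abs_nonneg C₁]
  rw [Real.dist_eq, abs_lt]
  constructor <;> linarith

end RealVariable

/-! ## §2 The logarithmic derivatives of the two per-plaquette constants -/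

section Derivatives

/-- `(log I₀)'(β) = I₁(β)/I₀(β)` (`I₀' = I₁`, `I₀ > 0`). [folklore] -/
theorem hasDerivAt_log_besselI_zero (β : ℝ) :
    HasDerivAt (fun x => Real.log (besselI 0 x)) (besselI 1 β / besselI 0 β) β :=
  (hasDerivAt_besselI_zero β).log (besselI_zero_pos β).ne'

/-- `(log BC₁²)'(β) = I₁(β/2)/I₀(β/2)·… − I₁(β)/I₀(β)`: precisely
`(2 log I₀(β/2) − log I₀(β))' = I₁(β/2)/I₀(β/2) − I₁(β)/I₀(β)`. [ours] -/
theorem hasDerivAt_log_bhattSq (β : ℝ) :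
    HasDerivAt (fun x => 2 * Real.log (besselI 0 (x / 2)) - Real.log (besselI 0 x))
      (besselI 1 (β / 2) / besselI 0 (β / 2) - besselI 1 β / besselI 0 β) β := by
  have h1 : HasDerivAt (fun x => Real.log (besselI 0 (x / 2)))
      (besselI 1 (β / 2) / besselI 0 (β / 2) * 2⁻¹) β := by
    have h := (hasDerivAt_log_besselI_zero (β / 2)).comp β ((hasDerivAt_id β).div_const 2)
    simpa [Function.comp_def] using h
  exact ((h1.const_mul 2).sub (hasDerivAt_log_besselI_zero β)).congr_deriv (by ring)

/-- `(log ESS₁)'(β) = (2 log I₀(β) − log I₀(2β))' = 2 I₁(β)/I₀(β) − 2 I₁(2β)/I₀(2β)`. [ours] -/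
theorem hasDerivAt_log_essOne (β : ℝ) :
    HasDerivAt (fun x => 2 * Real.log (besselI 0 x) - Real.log (besselI 0 (2 * x)))
      (2 * (besselI 1 β / besselI 0 β) - 2 * (besselI 1 (2 * β) / besselI 0 (2 * β))) β := by
  have h1 : HasDerivAt (fun x => Real.log (besselI 0 (2 * x)))
      (besselI 1 (2 * β) / besselI 0 (2 * β) * 2) β := by
    have h := (hasDerivAt_log_besselI_zero (2 * β)).comp β ((hasDerivAt_id β).const_mul 2)
    simpa [Function.comp_def] using h
  exact (((hasDerivAt_log_besselI_zero β).const_mul 2).sub h1).congr_deriv (by ring)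

/-- **`β·(log BC₁²)'(β) → −½`**: `β(I₁(β/2)/I₀(β/2) − I₁(β)/I₀(β)) = β(1 − I₁/I₀)(β) −
2·(β/2)(1 − I₁/I₀)(β/2) → ½ − 1`. [ours] -/
theorem tendsto_mul_deriv_log_bhattSq :
    Tendsto (fun β : ℝ => β * (besselI 1 (β / 2) / besselI 0 (β / 2) - besselI 1 β / besselI 0 β))
      atTop (𝓝 (-(1 / 2))) := by
  have h1 : Tendsto (fun β : ℝ => β / 2 * (1 - besselI 1 (β / 2) / besselI 0 (β / 2))) atTop
      (𝓝 (1 / 2)) := tendsto_beta_mul_one_sub_besselRatio.comp (tendsto_id.atTop_div_const two_pos)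
  have h := tendsto_beta_mul_one_sub_besselRatio.sub (h1.const_mul 2)
  have e : (fun β : ℝ => β * (besselI 1 (β / 2) / besselI 0 (β / 2) - besselI 1 β / besselI 0 β))
      = fun β => β * (1 - besselI 1 β / besselI 0 β)
        - 2 * (β / 2 * (1 - besselI 1 (β / 2) / besselI 0 (β / 2))) := by
    funext β; ring
  rw [e]
  convert h using 2
  norm_num

/-- **`β·(log ESS₁)'(β) → −½`**: `β(2 I₁(β)/I₀(β) − 2 I₁(2β)/I₀(2β)) = (2β)(1 − I₁/I₀)(2β) −
2·β(1 − I₁/I₀)(β) → ½ − 1`. [ours] -/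
theorem tendsto_mul_deriv_log_essOne :
    Tendsto (fun β : ℝ => β * (2 * (besselI 1 β / besselI 0 β)
      - 2 * (besselI 1 (2 * β) / besselI 0 (2 * β)))) atTop (𝓝 (-(1 / 2))) := by
  have h1 : Tendsto (fun β : ℝ => 2 * β * (1 - besselI 1 (2 * β) / besselI 0 (2 * β))) atTop
      (𝓝 (1 / 2)) := tendsto_beta_mul_one_sub_besselRatio.comp (tendsto_id.const_mul_atTop two_pos)
  have h := h1.sub (tendsto_beta_mul_one_sub_besselRatio.const_mul 2)
  have e : (fun β : ℝ => β * (2 * (besselI 1 β / besselI 0 β)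
      - 2 * (besselI 1 (2 * β) / besselI 0 (2 * β))))
      = fun β => 2 * β * (1 - besselI 1 (2 * β) / besselI 0 (2 * β))
        - 2 * (β * (1 - besselI 1 β / besselI 0 β)) := by
    funext β; ring
  rw [e]
  convert h using 2
  norm_num

end Derivatives

/-! ## §3 The exponent `−1/2` per plaquette -/

section Exponent

/-- **`log(I₀(β/2)²/I₀(β))/log β → −½`**: the per-plaquette Bhattacharyya ceiling of the untrained
U(1) sampler decays like `β^{−1/2}`. [ours] -/
theorem tendsto_log_bhattSq_div_log :
    Tendsto (fun β : ℝ => Real.log (besselI 0 (β / 2) ^ 2 / besselI 0 β) / Real.log β) atTop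
      (𝓝 (-(1 / 2))) := by
  have e : ∀ β : ℝ, Real.log (besselI 0 (β / 2) ^ 2 / besselI 0 β)
      = 2 * Real.log (besselI 0 (β / 2)) - Real.log (besselI 0 β) := fun β => by
    rw [Real.log_div (pow_pos (besselI_zero_pos _) 2).ne' (besselI_zero_pos _).ne', Real.log_pow]
    push_cast; ring
  simp_rw [e]
  exact tendsto_div_log_of_tendsto_mul_hasDerivAt (a := 0) (fun x _ => hasDerivAt_log_bhattSq x)
    tendsto_mul_deriv_log_bhattSq

/-- **`log(I₀(β)²/I₀(2β))/log β → −½`**: the per-plaquette ESS of the untrained U(1) sampler decays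
like `β^{−1/2}`. [ours] -/
theorem tendsto_log_essOne_div_log :
    Tendsto (fun β : ℝ => Real.log (besselI 0 β ^ 2 / besselI 0 (2 * β)) / Real.log β) atTop
      (𝓝 (-(1 / 2))) := by
  have e : ∀ β : ℝ, Real.log (besselI 0 β ^ 2 / besselI 0 (2 * β))
      = 2 * Real.log (besselI 0 β) - Real.log (besselI 0 (2 * β)) := fun β => by
    rw [Real.log_div (pow_pos (besselI_zero_pos _) 2).ne' (besselI_zero_pos _).ne', Real.log_pow]
    push_cast; ring
  simp_rw [e]
  exact tendsto_div_log_of_tendsto_mul_hasDerivAt (a := 0) (fun x _ => hasDerivAt_log_essOne x)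
    tendsto_mul_deriv_log_essOne

/-- Powers: `log((·)^V)/log β → V·(−½)` for either constant. [ours] -/
theorem tendsto_log_pow_div_log {g : ℝ → ℝ} {c : ℝ}
    (h : Tendsto (fun β : ℝ => Real.log (g β) / Real.log β) atTop (𝓝 c)) (V : ℕ) :
    Tendsto (fun β : ℝ => Real.log (g β ^ V) / Real.log β) atTop (𝓝 ((V : ℝ) * c)) := by
  have h' := h.const_mul (V : ℝ)
  refine h'.congr fun β => ?_
  rw [Real.log_pow, mul_div_assoc]

end Exponent

/-! ## §4 `V` plaquettes: `ESS_V`, the ceiling and the acceptance all have exponent `−V/2` -/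

section Plaquettes

variable {ι : Type*} [Fintype ι]

/-- **`log ESS_V(β)/log β → −V/2`** for row 3's untrained U(1) sampler on `V = card ι` independent
plaquettes (`u1IdentityFlow_essFrac`: `ESS_V = (I₀(β)²/I₀(2β))^V`). [ours] -/
theorem u1IdentityFlow_log_essFrac_div_log_tendsto :
    Tendsto (fun β : ℝ => Real.log
        ((∫ x, ∏ i : ι, Real.exp (β * Real.cos (x i)) / onePlaquetteZ β
            ∂(Measure.pi fun _ : ι => volume.restrict (Ioc (0 : ℝ) (2 * π)))) ^ 2
          / ∫ x, (∏ i : ι, Real.exp (β * Real.cos (x i)) / onePlaquetteZ β) ^ 2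
              / ∏ _i : ι, (1 / (2 * π) : ℝ)
            ∂(Measure.pi fun _ : ι => volume.restrict (Ioc (0 : ℝ) (2 * π))))
        / Real.log β) atTop (𝓝 (-((Fintype.card ι : ℝ) / 2))) := by
  simp_rw [u1IdentityFlow_essFrac (ι := ι)]
  have h := tendsto_log_pow_div_log tendsto_log_essOne_div_log (Fintype.card ι)
  convert h using 2
  ring

/-- **`log acc_V(β)/log β → −V/2`**: the equilibrium acceptance of the untrained U(1) sampler
decays as the power `β^{−V/2}` (squeezed between `(8/9)·ESS_V` and the ceiling `BC₁^{2V}`, whose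
exponents coincide). [ours] -/
theorem u1IdentityFlow_log_meanAccept_div_log_tendsto :
    Tendsto (fun β : ℝ => Real.log (∫ x, ∫ x', min
        ((∏ i : ι, Real.exp (β * Real.cos (x i)) / onePlaquetteZ β) * ∏ _i : ι, (1 / (2 * π) : ℝ))
        ((∏ i : ι, Real.exp (β * Real.cos (x' i)) / onePlaquetteZ β) * ∏ _i : ι, (1 / (2 * π) : ℝ))
        ∂(Measure.pi fun _ : ι => volume.restrict (Ioc (0 : ℝ) (2 * π)))
        ∂(Measure.pi fun _ : ι => volume.restrict (Ioc (0 : ℝ) (2 * π))))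
        / Real.log β) atTop (𝓝 (-((Fintype.card ι : ℝ) / 2))) := by
  set V : ℕ := Fintype.card ι with hV
  -- the two envelopes and their common exponent
  have hE : ∀ β : ℝ, 0 < (besselI 0 β ^ 2 / besselI 0 (2 * β)) ^ V := fun β =>
    pow_pos (div_pos (pow_pos (besselI_zero_pos β) 2) (besselI_zero_pos _)) V
  have hB : ∀ β : ℝ, 0 < (besselI 0 (β / 2) ^ 2 / besselI 0 β) ^ V := fun β =>
    pow_pos (div_pos (pow_pos (besselI_zero_pos _) 2) (besselI_zero_pos _)) V
  have hlow : Tendsto (fun β : ℝ => Real.log (8 / 9 * (besselI 0 β ^ 2 / besselI 0 (2 * β)) ^ V)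
      / Real.log β) atTop (𝓝 (-((V : ℝ) / 2))) := by
    have h1 := tendsto_log_pow_div_log tendsto_log_essOne_div_log V
    have h2 : Tendsto (fun β : ℝ => Real.log (8 / 9) / Real.log β) atTop (𝓝 0) :=
      tendsto_const_nhds.div_atTop Real.tendsto_log_atTop
    have h := h2.add h1
    have e : ∀ β : ℝ, Real.log (8 / 9 * (besselI 0 β ^ 2 / besselI 0 (2 * β)) ^ V) / Real.log β
        = Real.log (8 / 9) / Real.log β
          + Real.log ((besselI 0 β ^ 2 / besselI 0 (2 * β)) ^ V) / Real.log β := fun β => by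
      rw [Real.log_mul (by norm_num) (hE β).ne', add_div]
    simp_rw [e]
    convert h using 2
    ring
  have hup : Tendsto (fun β : ℝ => Real.log ((besselI 0 (β / 2) ^ 2 / besselI 0 β) ^ V)
      / Real.log β) atTop (𝓝 (-((V : ℝ) / 2))) := by
    have h := tendsto_log_pow_div_log tendsto_log_bhattSq_div_log V
    convert h using 2; ring
  refine tendsto_of_tendsto_of_tendsto_of_le_of_le' hlow hup ?_ ?_
  · filter_upwards [eventually_gt_atTop (1 : ℝ)] with β hβ
    have hlog : 0 < Real.log β := Real.log_pos hβ
    have hmem := u1IdentityFlow_meanAccept_mem_Icc (ι := ι) β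
    exact div_le_div_of_nonneg_right (Real.log_le_log (mul_pos (by norm_num) (hE β)) hmem.1) hlog.le
  · filter_upwards [eventually_gt_atTop (1 : ℝ)] with β hβ
    have hlog : 0 < Real.log β := Real.log_pos hβ
    have hmem := u1IdentityFlow_meanAccept_mem_Icc (ι := ι) β
    have hpos : 0 < ∫ x, ∫ x', min
        ((∏ i : ι, Real.exp (β * Real.cos (x i)) / onePlaquetteZ β) * ∏ _i : ι, (1 / (2 * π) : ℝ))
        ((∏ i : ι, Real.exp (β * Real.cos (x' i)) / onePlaquetteZ β) * ∏ _i : ι, (1 / (2 * π) : ℝ))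
        ∂(Measure.pi fun _ : ι => volume.restrict (Ioc (0 : ℝ) (2 * π)))
        ∂(Measure.pi fun _ : ι => volume.restrict (Ioc (0 : ℝ) (2 * π))) :=
      lt_of_lt_of_le (mul_pos (by norm_num) (hE β)) hmem.1
    exact div_le_div_of_nonneg_right (Real.log_le_log hpos hmem.2) hlog.le

end Plaquettes

end Summit.Ventures.LatticeQCDFlow.Theory2

end
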